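import Summits.CriticalPhenomena.Ising3DConformalLimit.Theses.PlantedPinning
import Summits.CriticalPhenomena.Ising3DConformalLimit.Theses.LeeYangGap
import Summits.CriticalPhenomena.Ising3DConformalLimit.Theses.DiracCensus
import Summits.CriticalPhenomena.Ising3DConformalLimit.Theses.LatticeSDPCertificates
import Summits.CriticalPhenomena.Ising3DConformalLimit.Theses.MeanCurrentCircleLaw
import Summits.CriticalPhenomena.Ising3DConformalLimit.Theses.OctaveForgetting
import Summits.CriticalPhenomena.Ising3DConformalLimit.Theses.FKParityRobustness
import Summits.CriticalPhenomena.Ising3DConformalLimit.Theses.SubPtolemyInterlacing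
import Summits.CriticalPhenomena.Ising3DConformalLimit.Theses.LocalisationClock
import Summits.CriticalPhenomena.Ising3DConformalLimit.Theses.CoerciveSharpness
import Summits.CriticalPhenomena.Ising3DConformalLimit.Theorems.PerfectScreeningMoebiusLimitExistsTwoLeaf
import HarnessLib

/-!
# Two-leaf split glue for crux `MoebiusLimitExists` (item stmt-CriticalPhenomena-1344) in the spelling of EVERY wanting route
(line lead c14 of route PlantedPinning, 2026-08-17; `--supports stmt-CriticalPhenomena-1344`)

Item stmt-1344 — "the critical Ising correlators on `ℤ³` have a non-degenerate, Möbius-covariant pointwise scaling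
limit", the summit conjunct `Ising3DConformalLimit` minus its clause (iii) — is shared by fourteen routes, each of which
declares the same definiens under its own name.  The landed file `…PerfectScreeningMoebiusLimitExistsTwoLeaf.lean`
(lead c10) proves that the crux is EXACTLY the conjunction of the two open leaves

* `Leaf₁` = item stmt-CriticalPhenomena-1981 `HyperoctahedralRP.ExistsScaleCovariantLimit` (existence of a normalised,
  non-degenerate, translation-invariant, scale-covariant pointwise limit of `criticalCorr 3`), and
* `Leaf₂` = item stmt-CriticalPhenomena-1982 `HyperoctahedralRP.InversionUpgradeNormalised` (Polyakov's inversion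
  upgrade of every such Euclidean-invariant limit),

and supplies the glue `Leaf₁ → Leaf₂ → C` and the factorisation `C ↔ Leaf₁ ∧ Leaf₂` for the spellings
`PerfectScreening.MoebiusLimitExists`, `EnergyNotSigmaSquared.MoebiusLimit`, `AnomalousForcesInteraction.MoebiusLimit`,
`GammaForcesInteraction.MoebiusLimit`.  This file supplies the same two statements for the TEN remaining spellings —
`PlantedPinning`, `LeeYangGap`, `DiracCensus`, `MeanCurrentCircleLaw`, `LocalisationClock` (`MoebiusLimitExists`) and
`LatticeSDPCertificates`, `OctaveForgetting`, `FKParityRobustness`, `SubPtolemyInterlacing`, `CoerciveSharpness`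
(`MoebiusLimit`) — so that `ledger route edit <route> --split <Decl> --glue-by <…_of_leaves>` can be run on ANY of the
fourteen routes without a glue item.  Pure assembly (every definiens is the same term); no definitions, no `sorry`.

References: H. Duminil-Copin, *100 years of the (critical) Ising model on the hypercubic lattice*, Proc. ICM 2022,
§8.4 p. 29 (existence and conformal invariance of the `ℤ³` scaling limit are open); A. M. Polyakov, JETP Lett. 12
(1970) 381 (the inversion upgrade).
-/

noncomputable section

open Summit.CriticalPhenomena.Ising3DConformalLimit.Theses
open Summit.CriticalPhenomena.Ising3DConformalLimit.MoebiusLimitExistsTwoLeaf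
  (MoebiusLimitExists_of_leaves MoebiusLimitExists_iff_leaves)

namespace Summit.CriticalPhenomena.Ising3DConformalLimit.MoebiusLimitExistsTwoLeaf

/-! ### `PlantedPinning.MoebiusLimitExists` (route PlantedPinning, r5 imported complement) -/

/-- **GLUE for route PlantedPinning**: existence (item 1981) and the inversion upgrade (item 1982) give
`PlantedPinning.MoebiusLimitExists`. [cite: DuminilCopinICM2022, §8.4 p. 29] -/
theorem plantedPinning_MoebiusLimitExists_of_leaves
    (h1981 : HyperoctahedralRP.ExistsScaleCovariantLimit)
    (h1982 : HyperoctahedralRP.InversionUpgradeNormalised) :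
    PlantedPinning.MoebiusLimitExists :=
  MoebiusLimitExists_of_leaves h1981 h1982

/-- `PlantedPinning.MoebiusLimitExists ⟺ 1981 ∧ 1982` (each leaf necessary); registered census anchor of line `Sketch`
(lead c14) in the spelling of route PlantedPinning. [cite: DuminilCopinICM2022, §8.4 p. 29] -/
theorem plantedPinning_MoebiusLimitExists_iff_leaves :
    Summit.CriticalPhenomena.Ising3DConformalLimit.Theses.PlantedPinning.MoebiusLimitExists ↔
      Summit.CriticalPhenomena.Ising3DConformalLimit.Theses.HyperoctahedralRP.ExistsScaleCovariantLimit ∧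
        Summit.CriticalPhenomena.Ising3DConformalLimit.Theses.HyperoctahedralRP.InversionUpgradeNormalised :=
  MoebiusLimitExists_iff_leaves

/-! ### `LeeYangGap.MoebiusLimitExists` -/

/-- GLUE for route LeeYangGap. [cite: DuminilCopinICM2022, §8.4 p. 29] -/
theorem leeYangGap_MoebiusLimitExists_of_leaves
    (h1981 : HyperoctahedralRP.ExistsScaleCovariantLimit)
    (h1982 : HyperoctahedralRP.InversionUpgradeNormalised) :
    LeeYangGap.MoebiusLimitExists :=
  MoebiusLimitExists_of_leaves h1981 h1982

/-- `LeeYangGap.MoebiusLimitExists ⟺ 1981 ∧ 1982`. [cite: DuminilCopinICM2022, §8.4 p. 29] -/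
theorem leeYangGap_MoebiusLimitExists_iff_leaves :
    LeeYangGap.MoebiusLimitExists ↔
      HyperoctahedralRP.ExistsScaleCovariantLimit ∧ HyperoctahedralRP.InversionUpgradeNormalised :=
  MoebiusLimitExists_iff_leaves

/-! ### `DiracCensus.MoebiusLimitExists` -/

/-- GLUE for route DiracCensus. [cite: DuminilCopinICM2022, §8.4 p. 29] -/
theorem diracCensus_MoebiusLimitExists_of_leaves
    (h1981 : HyperoctahedralRP.ExistsScaleCovariantLimit)
    (h1982 : HyperoctahedralRP.InversionUpgradeNormalised) :
    DiracCensus.MoebiusLimitExists :=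
  MoebiusLimitExists_of_leaves h1981 h1982

/-- `DiracCensus.MoebiusLimitExists ⟺ 1981 ∧ 1982`. [cite: DuminilCopinICM2022, §8.4 p. 29] -/
theorem diracCensus_MoebiusLimitExists_iff_leaves :
    DiracCensus.MoebiusLimitExists ↔
      HyperoctahedralRP.ExistsScaleCovariantLimit ∧ HyperoctahedralRP.InversionUpgradeNormalised :=
  MoebiusLimitExists_iff_leaves

/-! ### `MeanCurrentCircleLaw.MoebiusLimitExists` -/

/-- GLUE for route MeanCurrentCircleLaw. [cite: DuminilCopinICM2022, §8.4 p. 29] -/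
theorem meanCurrentCircleLaw_MoebiusLimitExists_of_leaves
    (h1981 : HyperoctahedralRP.ExistsScaleCovariantLimit)
    (h1982 : HyperoctahedralRP.InversionUpgradeNormalised) :
    MeanCurrentCircleLaw.MoebiusLimitExists :=
  MoebiusLimitExists_of_leaves h1981 h1982

/-- `MeanCurrentCircleLaw.MoebiusLimitExists ⟺ 1981 ∧ 1982`. [cite: DuminilCopinICM2022, §8.4 p. 29] -/
theorem meanCurrentCircleLaw_MoebiusLimitExists_iff_leaves :
    MeanCurrentCircleLaw.MoebiusLimitExists ↔
      HyperoctahedralRP.ExistsScaleCovariantLimit ∧ HyperoctahedralRP.InversionUpgradeNormalised :=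
  MoebiusLimitExists_iff_leaves

/-! ### `LocalisationClock.MoebiusLimitExists` -/

/-- GLUE for route LocalisationClock. [cite: DuminilCopinICM2022, §8.4 p. 29] -/
theorem localisationClock_MoebiusLimitExists_of_leaves
    (h1981 : HyperoctahedralRP.ExistsScaleCovariantLimit)
    (h1982 : HyperoctahedralRP.InversionUpgradeNormalised) :
    LocalisationClock.MoebiusLimitExists :=
  MoebiusLimitExists_of_leaves h1981 h1982

/-- `LocalisationClock.MoebiusLimitExists ⟺ 1981 ∧ 1982`. [cite: DuminilCopinICM2022, §8.4 p. 29] -/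
theorem localisationClock_MoebiusLimitExists_iff_leaves :
    LocalisationClock.MoebiusLimitExists ↔
      HyperoctahedralRP.ExistsScaleCovariantLimit ∧ HyperoctahedralRP.InversionUpgradeNormalised :=
  MoebiusLimitExists_iff_leaves

/-! ### `LatticeSDPCertificates.MoebiusLimit` -/

/-- GLUE for route LatticeSDPCertificates. [cite: DuminilCopinICM2022, §8.4 p. 29] -/
theorem latticeSDPCertificates_MoebiusLimit_of_leaves
    (h1981 : HyperoctahedralRP.ExistsScaleCovariantLimit)
    (h1982 : HyperoctahedralRP.InversionUpgradeNormalised) :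
    LatticeSDPCertificates.MoebiusLimit :=
  MoebiusLimitExists_of_leaves h1981 h1982

/-- `LatticeSDPCertificates.MoebiusLimit ⟺ 1981 ∧ 1982`. [cite: DuminilCopinICM2022, §8.4 p. 29] -/
theorem latticeSDPCertificates_MoebiusLimit_iff_leaves :
    LatticeSDPCertificates.MoebiusLimit ↔
      HyperoctahedralRP.ExistsScaleCovariantLimit ∧ HyperoctahedralRP.InversionUpgradeNormalised :=
  MoebiusLimitExists_iff_leaves

/-! ### `OctaveForgetting.MoebiusLimit` -/

/-- GLUE for route OctaveForgetting. [cite: DuminilCopinICM2022, §8.4 p. 29] -/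
theorem octaveForgetting_MoebiusLimit_of_leaves
    (h1981 : HyperoctahedralRP.ExistsScaleCovariantLimit)
    (h1982 : HyperoctahedralRP.InversionUpgradeNormalised) :
    OctaveForgetting.MoebiusLimit :=
  MoebiusLimitExists_of_leaves h1981 h1982

/-- `OctaveForgetting.MoebiusLimit ⟺ 1981 ∧ 1982`. [cite: DuminilCopinICM2022, §8.4 p. 29] -/
theorem octaveForgetting_MoebiusLimit_iff_leaves :
    OctaveForgetting.MoebiusLimit ↔
      HyperoctahedralRP.ExistsScaleCovariantLimit ∧ HyperoctahedralRP.InversionUpgradeNormalised :=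
  MoebiusLimitExists_iff_leaves

/-! ### `FKParityRobustness.MoebiusLimit` -/

/-- GLUE for route FKParityRobustness. [cite: DuminilCopinICM2022, §8.4 p. 29] -/
theorem fkParityRobustness_MoebiusLimit_of_leaves
    (h1981 : HyperoctahedralRP.ExistsScaleCovariantLimit)
    (h1982 : HyperoctahedralRP.InversionUpgradeNormalised) :
    FKParityRobustness.MoebiusLimit :=
  MoebiusLimitExists_of_leaves h1981 h1982

/-- `FKParityRobustness.MoebiusLimit ⟺ 1981 ∧ 1982`. [cite: DuminilCopinICM2022, §8.4 p. 29] -/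
theorem fkParityRobustness_MoebiusLimit_iff_leaves :
    FKParityRobustness.MoebiusLimit ↔
      HyperoctahedralRP.ExistsScaleCovariantLimit ∧ HyperoctahedralRP.InversionUpgradeNormalised :=
  MoebiusLimitExists_iff_leaves

/-! ### `SubPtolemyInterlacing.MoebiusLimit` -/

/-- GLUE for route SubPtolemyInterlacing. [cite: DuminilCopinICM2022, §8.4 p. 29] -/
theorem subPtolemyInterlacing_MoebiusLimit_of_leaves
    (h1981 : HyperoctahedralRP.ExistsScaleCovariantLimit)
    (h1982 : HyperoctahedralRP.InversionUpgradeNormalised) :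
    SubPtolemyInterlacing.MoebiusLimit :=
  MoebiusLimitExists_of_leaves h1981 h1982

/-- `SubPtolemyInterlacing.MoebiusLimit ⟺ 1981 ∧ 1982`. [cite: DuminilCopinICM2022, §8.4 p. 29] -/
theorem subPtolemyInterlacing_MoebiusLimit_iff_leaves :
    SubPtolemyInterlacing.MoebiusLimit ↔
      HyperoctahedralRP.ExistsScaleCovariantLimit ∧ HyperoctahedralRP.InversionUpgradeNormalised :=
  MoebiusLimitExists_iff_leaves

/-! ### `CoerciveSharpness.MoebiusLimit` -/

/-- GLUE for route CoerciveSharpness. [cite: DuminilCopinICM2022, §8.4 p. 29] -/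
theorem coerciveSharpness_MoebiusLimit_of_leaves
    (h1981 : HyperoctahedralRP.ExistsScaleCovariantLimit)
    (h1982 : HyperoctahedralRP.InversionUpgradeNormalised) :
    CoerciveSharpness.MoebiusLimit :=
  MoebiusLimitExists_of_leaves h1981 h1982

/-- `CoerciveSharpness.MoebiusLimit ⟺ 1981 ∧ 1982`. [cite: DuminilCopinICM2022, §8.4 p. 29] -/
theorem coerciveSharpness_MoebiusLimit_iff_leaves :
    CoerciveSharpness.MoebiusLimit ↔
      HyperoctahedralRP.ExistsScaleCovariantLimit ∧ HyperoctahedralRP.InversionUpgradeNormalised :=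
  MoebiusLimitExists_iff_leaves

/-! ### All fourteen spellings are one proposition -/

/-- The fourteen route spellings of item stmt-1344 are pairwise equivalent (indeed the same term); recorded once, with
`PerfectScreening.MoebiusLimitExists` as the hub. [cite: DuminilCopinICM2022, §8.4 p. 29] -/
theorem spellings_iff_perfectScreening :
    (PlantedPinning.MoebiusLimitExists ↔ PerfectScreening.MoebiusLimitExists) ∧
    (LeeYangGap.MoebiusLimitExists ↔ PerfectScreening.MoebiusLimitExists) ∧
    (DiracCensus.MoebiusLimitExists ↔ PerfectScreening.MoebiusLimitExists) ∧
    (MeanCurrentCircleLaw.MoebiusLimitExists ↔ PerfectScreening.MoebiusLimitExists) ∧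
    (LocalisationClock.MoebiusLimitExists ↔ PerfectScreening.MoebiusLimitExists) ∧
    (LatticeSDPCertificates.MoebiusLimit ↔ PerfectScreening.MoebiusLimitExists) ∧
    (OctaveForgetting.MoebiusLimit ↔ PerfectScreening.MoebiusLimitExists) ∧
    (FKParityRobustness.MoebiusLimit ↔ PerfectScreening.MoebiusLimitExists) ∧
    (SubPtolemyInterlacing.MoebiusLimit ↔ PerfectScreening.MoebiusLimitExists) ∧
    (CoerciveSharpness.MoebiusLimit ↔ PerfectScreening.MoebiusLimitExists) :=
  ⟨Iff.rfl, Iff.rfl, Iff.rfl, Iff.rfl, Iff.rfl, Iff.rfl, Iff.rfl, Iff.rfl, Iff.rfl, Iff.rfl⟩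

end Summit.CriticalPhenomena.Ising3DConformalLimit.MoebiusLimitExistsTwoLeaf

end
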